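import Summits.CriticalPhenomena.PercolationContinuityZ3.Theses.PercRayRenewal
import Literature.Probability.Percolation.UniformPercolation
import Literature.Probability.Percolation.HalfSpaceBrickSeeds

/-!
# The box chain: `JumpTruncatedOneArmDecay → JumpLineAvoidanceDecay`

Route `PercRayRenewal` of `PercolationContinuityZ3`, support item `BoxChainLineAvoidance`
(stmt-CriticalPhenomena-4628): if the truncated one-arm probability
`π^f_n = P_{p_c}(0 ↔ ∂Λ(n) in Λ(n), |C(0)| < ∞)` decays like `C n^{-a}` for some `a > 0`
(and `θ(p_c) > 0`), then the line-avoidance probability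
`e_m = P_{p_c}(none of e₀, 2e₀, …, m e₀ lies in an infinite cluster)` decays like `C' m^{-κ}`
for some `κ > 0`.

Proof (Grimmett 1999 §2.2/§5-style block argument, as filed by the planner). Place `K` boxes
`Λ(n) + c_j e₀` with centres `c_j = (2n+1) j`, `j = 1, …, K`, on the axis segment `{1, …, m}`
(possible when `(2n+1) K ≤ m`); consecutive centres are `2n+1` apart, so the boxes are pairwise
disjoint. On the event `E_m = {∀ 1 ≤ i ≤ m, i e₀ ∉ C_∞}` either some centre is joined to the
boundary of its box inside the box — then the translate of the truncated arm event
`{0 ↔ ∂Λ(n) in Λ(n)} \ {|C(0)| = ∞}` occurs at that centre (union bound: `K π^f_n`, translation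
invariance, `real_armEvent_diff_percolatesAt` of `UniformPercolation.lean`) — or no centre is:
an intersection of `K` events determined by the pairwise disjoint sets of pairs of the boxes,
hence of probability `∏ (1 - P(0 ↔ ∂Λ(n))) ≤ (1 - θ(p_c))^K`
(`bondPercolation_real_biInter_eq_prod`, `determinedBy_zdArmEvent`, `disjoint_sym2_shiftedBox`,
`DCT16.theta_le_real_siteToBoundary`). This is `boxChain_real_le`. The decay statement follows
with `K = k`, `n = k^s` for an integer `s > 2/a` and `k = ⌊(m/3)^{1/(s+1)}⌋`, using the
elementary bound `(1-θ)^k ≤ 1/(kθ)` (Bernoulli's inequality); the exponent is `κ = 1/(s+1)`.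

References: G. Grimmett, *Percolation*, 2nd ed. (1999), §1.4 (`θ(p) ≤ P_p(0 ↔ ∂B(n))`),
§2.2 (events depending on disjoint edge sets are independent).
-/

namespace Summit.CriticalPhenomena.PercolationContinuityZ3.Theorems

open MeasureTheory Literature.Probability.Percolation Literature.Probability.LatticeModels

/-- **The box chain bound.** For centres `c_j = (2n+1)(j+1)`, `j < K`, with `(2n+1) K ≤ m`:
`P(∀ 1 ≤ i ≤ m, i e₀ ∉ C_∞) ≤ K · P({0 ↔ ∂Λ(n)} \ {|C(0)| = ∞}) + (1 - θ(p_c))^K`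
(union bound over the translated truncated arm events, and independence of the complements of
the arm events of the pairwise disjoint boxes). [folklore] -/
theorem boxChain_real_le (n K m : ℕ) (hm : (2 * n + 1) * K ≤ m) :
    (bondPercolation (zdGraph 3) (criticalProbI 3)).real
        {ω | ∀ i : ℕ, 1 ≤ i → i ≤ m → ω ∉ percolatesAt (Pi.single 0 (i : ℤ) : Site 3)} ≤
      K * (bondPercolation (zdGraph 3) (criticalProbI 3)).real
          (siteToBoundary 3 n \ percolatesAt 0) +
        (1 - theta (zdGraph 3) 0 (criticalProbI 3)) ^ K := by
  -- centres and their sites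
  set c : ℕ → ℕ := fun j => (2 * n + 1) * (j + 1) with hc
  set v : ℕ → Site 3 := fun j => (Pi.single 0 ((c j : ℕ) : ℤ) : Site 3) with hv
  have hc1 : ∀ j, 1 ≤ c j := fun j => by
    simp only [hc]; nlinarith
  have hcm : ∀ j, j < K → c j ≤ m := fun j hj => by
    simp only [hc]
    exact le_trans (Nat.mul_le_mul_left _ hj) hm
  have hsep : ∀ j j', j < j' → c j + 2 * n < c j' := fun j j' hjj' => by
    simp only [hc]
    have : (2 * n + 1) * (j + 2) ≤ (2 * n + 1) * (j' + 1) := Nat.mul_le_mul_left _ (by omega)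
    nlinarith
  -- boxes around separated centres are separated
  have hbox : ∀ j j', j ≠ j' → v j' - v j ∉ box 3 (2 * n) := fun j j' hjj' hmem => by
    have h0 := (mem_box.1 hmem) 0
    simp only [hv, Pi.sub_apply, Pi.single_eq_same] at h0
    rcases Nat.lt_or_gt_of_ne hjj' with hlt | hlt
    · have := hsep j j' hlt; omega
    · have := hsep j' j hlt; omega
  set μ := bondPercolation (zdGraph 3) (criticalProbI 3) with hμ
  set A : ℕ → Set (BondConfig (Site 3)) := fun j => DCT16.armEvent (v j) n \ percolatesAt (v j)
    with hA
  set B : ℕ → Set (BondConfig (Site 3)) := fun j => (DCT16.armEvent (v j) n)ᶜ with hB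
  set s : Finset ℕ := Finset.range K with hs
  -- the inclusion
  have hincl : {ω : BondConfig (Site 3) | ∀ i : ℕ, 1 ≤ i → i ≤ m →
      ω ∉ percolatesAt (Pi.single 0 (i : ℤ) : Site 3)} ⊆ (⋃ j ∈ s, A j) ∪ (⋂ j ∈ s, B j) := by
    intro ω hω
    by_cases h : ∃ j ∈ s, ω ∈ DCT16.armEvent (v j) n
    · obtain ⟨j, hj, hωj⟩ := h
      refine Or.inl (Set.mem_biUnion hj ⟨hωj, ?_⟩)
      exact hω (c j) (hc1 j) (hcm j (Finset.mem_range.1 hj))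
    · push Not at h
      exact Or.inr (Set.mem_iInter₂.2 fun j hj => h j hj)
  -- the union bound (translation invariance of the truncated arm probability)
  have hUnion : μ.real (⋃ j ∈ s, A j) ≤ K * μ.real (siteToBoundary 3 n \ percolatesAt 0) := by
    refine (measureReal_biUnion_finset_le s A).trans ?_
    have : ∀ j ∈ s, μ.real (A j) = μ.real (siteToBoundary 3 n \ percolatesAt 0) := fun j _ => by
      simp only [hA, hμ]
      rw [real_armEvent_diff_percolatesAt, ← DCT16.armEvent_zero 3 n,
        real_armEvent_diff_percolatesAt, DCT16.armEvent_zero]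
    rw [Finset.sum_congr rfl this, Finset.sum_const, Finset.card_range, nsmul_eq_mul]
  -- the product (independence over the disjoint boxes)
  have hdet : ∀ j ∈ s, DeterminedBy (B j) {z : Site 3 | z - v j ∈ box 3 n}.sym2 := fun j _ =>
    (determinedBy_zdArmEvent (v j) n).compl
  have hmeas : ∀ j ∈ s, MeasurableSet (B j) := fun j _ => (measurableSet_zdArmEvent (v j) n).compl
  have hdisj : (↑s : Set ℕ).PairwiseDisjoint fun j => {z : Site 3 | z - v j ∈ box 3 n}.sym2 :=
    fun j _ j' _ hjj' => disjoint_sym2_shiftedBox (hbox j j' hjj')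
  have hθ : ∀ j ∈ s, μ.real (B j) ≤ 1 - theta (zdGraph 3) 0 (criticalProbI 3) := fun j _ => by
    simp only [hB, hμ]
    rw [probReal_compl_eq_one_sub (measurableSet_zdArmEvent (v j) n), DCT16.real_armEvent]
    linarith [DCT16.theta_le_real_siteToBoundary (d := 3) (criticalProbI 3) n]
  have hInter : μ.real (⋂ j ∈ s, B j) ≤ (1 - theta (zdGraph 3) 0 (criticalProbI 3)) ^ K := by
    rw [hμ, bondPercolation_real_biInter_eq_prod (zdGraph 3) (criticalProbI 3) s B _ hdet hmeas hdisj]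
    calc ∏ j ∈ s, (bondPercolation (zdGraph 3) (criticalProbI 3)).real (B j)
        ≤ ∏ _j ∈ s, (1 - theta (zdGraph 3) 0 (criticalProbI 3)) :=
          Finset.prod_le_prod (fun _ _ => measureReal_nonneg) hθ
      _ = (1 - theta (zdGraph 3) 0 (criticalProbI 3)) ^ K := by
          rw [Finset.prod_const, Finset.card_range]
  calc μ.real {ω | ∀ i : ℕ, 1 ≤ i → i ≤ m → ω ∉ percolatesAt (Pi.single 0 (i : ℤ) : Site 3)}
      ≤ μ.real ((⋃ j ∈ s, A j) ∪ (⋂ j ∈ s, B j)) := measureReal_mono hincl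
    _ ≤ μ.real (⋃ j ∈ s, A j) + μ.real (⋂ j ∈ s, B j) := measureReal_union_le _ _
    _ ≤ _ := add_le_add hUnion hInter

/-- Bernoulli: for `0 < θ ≤ 1` and `k ≥ 1`, `(1 - θ)^k ≤ 1 / (k θ)`
(from `(1-θ)^k (1 + kθ) ≤ (1-θ)^k (1+θ)^k = (1-θ²)^k ≤ 1`). [folklore] -/
theorem one_sub_pow_le_one_div_mul {θ : ℝ} (hθ : 0 < θ) (hθ1 : θ ≤ 1) {k : ℕ} (hk : 1 ≤ k) :
    (1 - θ) ^ k ≤ 1 / (k * θ) := by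
  have hk0 : (0 : ℝ) < k := by exact_mod_cast hk
  have h1 : (1 - θ) ^ k * (1 + k * θ) ≤ 1 :=
    calc (1 - θ) ^ k * (1 + k * θ) ≤ (1 - θ) ^ k * (1 + θ) ^ k :=
          mul_le_mul_of_nonneg_left (one_add_mul_le_pow (by linarith) k) (pow_nonneg (by linarith) k)
      _ = ((1 - θ) * (1 + θ)) ^ k := (mul_pow _ _ _).symm
      _ ≤ 1 := pow_le_one₀ (by nlinarith) (by nlinarith)
  rw [le_div_iff₀ (by positivity)]
  calc (1 - θ) ^ k * (k * θ) ≤ (1 - θ) ^ k * (1 + k * θ) :=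
        mul_le_mul_of_nonneg_left (by linarith) (pow_nonneg (by linarith) k)
    _ ≤ 1 := h1

/-- **`BoxChainLineAvoidance`** (route `PercRayRenewal`, item stmt-CriticalPhenomena-4628):
power-law decay of the truncated one-arm probability in the jump world implies power-law decay of
the line-avoidance probability, by the box chain `boxChain_real_le` with `K = k` boxes of radius
`n = k^s`, `s > 2/a`, `k = ⌊(m/3)^{1/(s+1)}⌋`; the exponent is `κ = 1/(s+1)` and the constant
`max 2 (6 (C + 1/θ(p_c)))`. [folklore] -/
theorem boxChainLineAvoidance_proof :
    Summit.CriticalPhenomena.PercolationContinuityZ3.Theses.PercRayRenewal.BoxChainLineAvoidance := by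
  unfold Summit.CriticalPhenomena.PercolationContinuityZ3.Theses.PercRayRenewal.BoxChainLineAvoidance
  intro hdecay hθ
  obtain ⟨a, C, ha, hC⟩ := hdecay hθ
  set θ := theta (zdGraph 3) 0 (criticalProbI 3) with hθdef
  set μ := bondPercolation (zdGraph 3) (criticalProbI 3) with hμ
  have hθ1 : θ ≤ 1 := measureReal_le_one
  have hC0 : 0 ≤ C := by
    have h := hC 1 le_rfl
    simp only [Nat.cast_one, Real.one_rpow, mul_one] at h
    exact le_trans measureReal_nonneg h
  obtain ⟨s, hs⟩ := exists_nat_gt (2 / a)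
  have hsa : 2 < (s : ℝ) * a := by rwa [div_lt_iff₀ ha] at hs
  set N : ℕ := s + 1 with hN
  have hN1 : (1 : ℝ) ≤ N := by simp only [hN]; exact_mod_cast Nat.le_add_left 1 s
  set κ : ℝ := (N : ℝ)⁻¹ with hκ
  have hκ0 : 0 < κ := by positivity
  have hκ1 : κ ≤ 1 := inv_le_one_of_one_le₀ hN1
  refine ⟨κ, max 2 (6 * (C + 1 / θ)), hκ0, fun m hm => ?_⟩
  have hm0 : (0 : ℝ) < m := by exact_mod_cast hm
  have hm1 : (1 : ℝ) ≤ m := by exact_mod_cast hm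
  have hmκ : 0 < (m : ℝ) ^ (-κ) := Real.rpow_pos_of_pos hm0 _
  by_cases hm3 : m < 3
  · -- small `m`: the probability is at most `1 ≤ 2 m^{-κ}`
    have h2 : (1 : ℝ) ≤ 2 * (m : ℝ) ^ (-κ) := by
      have hle : (m : ℝ) ^ κ ≤ 2 := by
        calc (m : ℝ) ^ κ ≤ (m : ℝ) ^ (1 : ℝ) := Real.rpow_le_rpow_of_exponent_le hm1 hκ1
          _ = m := Real.rpow_one _
          _ ≤ 2 := by exact_mod_cast Nat.lt_succ_iff.1 hm3
      rw [Real.rpow_neg hm0.le]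
      rw [← div_eq_mul_inv, le_div_iff₀ (Real.rpow_pos_of_pos hm0 _)]
      linarith
    calc μ.real {ω | ∀ i : ℕ, 1 ≤ i → i ≤ m → ω ∉ percolatesAt (Pi.single 0 (i : ℤ) : Site 3)}
        ≤ 1 := measureReal_le_one
      _ ≤ 2 * (m : ℝ) ^ (-κ) := h2
      _ ≤ max 2 (6 * (C + 1 / θ)) * (m : ℝ) ^ (-κ) :=
          mul_le_mul_of_nonneg_right (le_max_left _ _) hmκ.le
  · push Not at hm3
    -- the scale `k = ⌊(m/3)^κ⌋ ≥ 1`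
    set x : ℝ := ((m : ℝ) / 3) ^ κ with hx
    have hx0 : 0 ≤ x := Real.rpow_nonneg (by positivity) _
    have hm3' : (1 : ℝ) ≤ (m : ℝ) / 3 := by
      rw [le_div_iff₀ (by norm_num : (0 : ℝ) < 3)]; exact_mod_cast (by omega : 3 ≤ m)
    have hx1 : 1 ≤ x := Real.one_le_rpow hm3' hκ0.le
    set k : ℕ := ⌊x⌋₊ with hk
    have hk1 : 1 ≤ k := Nat.le_floor (by exact_mod_cast hx1)
    have hk0 : (0 : ℝ) < k := by exact_mod_cast hk1
    have hkx : (k : ℝ) ≤ x := Nat.floor_le hx0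
    have hxk : x < k + 1 := Nat.lt_floor_add_one x
    -- `3 k^N ≤ m`
    have hkN : 3 * k ^ N ≤ m := by
      have h1 : (k : ℝ) ^ N ≤ (m : ℝ) / 3 := by
        calc (k : ℝ) ^ N ≤ x ^ N := pow_le_pow_left₀ hk0.le hkx N
          _ = (m : ℝ) / 3 := Real.rpow_inv_natCast_pow (by positivity) (by simp [hN])
      have h2 : (3 : ℝ) * k ^ N ≤ m := by
        rw [le_div_iff₀ (by norm_num : (0 : ℝ) < 3)] at h1; linarith
      exact_mod_cast h2
    -- `m^κ ≤ 6 k`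
    have hmk : (m : ℝ) ^ κ ≤ 6 * k := by
      have h3 : (3 : ℝ) ^ κ ≤ 3 := by
        calc (3 : ℝ) ^ κ ≤ (3 : ℝ) ^ (1 : ℝ) :=
              Real.rpow_le_rpow_of_exponent_le (by norm_num) hκ1
          _ = 3 := Real.rpow_one _
      have hm' : (m : ℝ) = 3 * ((m : ℝ) / 3) := by ring
      calc (m : ℝ) ^ κ = (3 : ℝ) ^ κ * x := by
            rw [hm', Real.mul_rpow (by norm_num) (by positivity)]
        _ ≤ 3 * (k + 1) := mul_le_mul h3 hxk.le hx0 (by norm_num)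
        _ ≤ 6 * k := by
            have : (1 : ℝ) ≤ k := by exact_mod_cast hk1
            linarith
    -- the box chain with `K = k` boxes of radius `n = k^s`
    have hfit : (2 * k ^ s + 1) * k ≤ m := by
      refine le_trans ?_ hkN
      have hks : 1 ≤ k ^ s := Nat.one_le_pow _ _ hk1
      calc (2 * k ^ s + 1) * k ≤ (3 * k ^ s) * k := Nat.mul_le_mul_right k (by omega)
        _ = 3 * k ^ N := by simp only [hN, pow_succ]; ring
    have hcore := boxChain_real_le (k ^ s) k m hfit
    have hF := hC (k ^ s) (Nat.one_le_pow _ _ hk1)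
    -- `k · C (k^s)^{-a} ≤ C / k`
    have hterm1 : (k : ℝ) * (C * ((k ^ s : ℕ) : ℝ) ^ (-a)) ≤ C / k := by
      have hk1' : (1 : ℝ) ≤ k := by exact_mod_cast hk1
      have e1 : ((k ^ s : ℕ) : ℝ) ^ (-a) = (k : ℝ) ^ ((s : ℝ) * (-a)) := by
        rw [Nat.cast_pow, ← Real.rpow_natCast, ← Real.rpow_mul hk0.le]
      have e2 : (k : ℝ) * (k : ℝ) ^ ((s : ℝ) * (-a)) = (k : ℝ) ^ (1 + (s : ℝ) * (-a)) := by
        rw [Real.rpow_add hk0, Real.rpow_one]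
      have e3 : (k : ℝ) ^ (1 + (s : ℝ) * (-a)) ≤ (k : ℝ) ^ (-1 : ℝ) :=
        Real.rpow_le_rpow_of_exponent_le hk1' (by nlinarith)
      calc (k : ℝ) * (C * ((k ^ s : ℕ) : ℝ) ^ (-a)) = C * ((k : ℝ) * (k : ℝ) ^ ((s : ℝ) * (-a))) := by
            rw [e1]; ring
        _ ≤ C * (k : ℝ) ^ (-1 : ℝ) := by
            rw [e2]; exact mul_le_mul_of_nonneg_left e3 hC0
        _ = C / k := by rw [Real.rpow_neg_one, div_eq_mul_inv]
    -- `(1-θ)^k ≤ 1/(kθ)`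
    have hterm2 : (1 - θ) ^ k ≤ 1 / (k * θ) := one_sub_pow_le_one_div_mul hθ hθ1 hk1
    -- `1/k ≤ 6 m^{-κ}`
    have hinvk : 1 / (k : ℝ) ≤ 6 * (m : ℝ) ^ (-κ) := by
      rw [Real.rpow_neg hm0.le, ← div_eq_mul_inv,
        div_le_div_iff₀ hk0 (Real.rpow_pos_of_pos hm0 _)]
      linarith
    have hCθ : 0 ≤ C + 1 / θ := by positivity
    calc μ.real {ω | ∀ i : ℕ, 1 ≤ i → i ≤ m → ω ∉ percolatesAt (Pi.single 0 (i : ℤ) : Site 3)}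
        ≤ k * μ.real (siteToBoundary 3 (k ^ s) \ percolatesAt 0) + (1 - θ) ^ k := hcore
      _ ≤ k * (C * ((k ^ s : ℕ) : ℝ) ^ (-a)) + 1 / (k * θ) :=
          add_le_add (mul_le_mul_of_nonneg_left hF hk0.le) hterm2
      _ ≤ C / k + 1 / (k * θ) := by linarith [hterm1]
      _ = (C + 1 / θ) * (1 / k) := by field_simp
      _ ≤ (C + 1 / θ) * (6 * (m : ℝ) ^ (-κ)) := mul_le_mul_of_nonneg_left hinvk hCθ
      _ = 6 * (C + 1 / θ) * (m : ℝ) ^ (-κ) := by ring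
      _ ≤ max 2 (6 * (C + 1 / θ)) * (m : ℝ) ^ (-κ) :=
          mul_le_mul_of_nonneg_right (le_max_right _ _) hmκ.le

end Summit.CriticalPhenomena.PercolationContinuityZ3.Theorems
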